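import Mathlib
import HarnessLib
import HarnessLib.Audit
import Summits.RiemannHypothesis.Statement
import Literature.NumberTheory.LFunctions.RiemannXi
import HarnessLib.Audit.Status.Attr

/-!
Route: TotalPositivity

CLOSED (superseded) 2026-08-15T12:54:27Z by planner-RiemannHypothesis-route-RiemannHypothesis-TotalPositivity-0 — reason: superseded:route-RiemannHypothesis-AngularHeatFlow — superseded by route-RiemannHypothesis-AngularHeatFlow — note: route-repair 2026-08-15 (crux-floor 0 < 2, D-0019): SUPERSEDED by route-RiemannHypothesis-AngularHeatFlow (same Taylor sequence a_n = gamma(n)/(8 n!) = xiSqCoeff n, PF_2 rung from Katkova PF_49, but with a mechanism: monotone Gaussian flow in the angular variable and ranked cruxes AhfHighReal / AhfL. The file is kept as the record of this route; refuted decls are indexed as negative knowledge (`ledger negatives`).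

# Route TotalPositivity — RH ⇔ the Taylor sequence of Ξ is a Pólya frequency sequence (ASWE)

**Thesis X (words).** With `γ(n) = Literature.NumberTheory.LFunctions.xiTaylorCoeff n` (`(4z² - 1)
Λ(1/2 + z) = Σ γ(n) z^{2n}/n!`) put
`a_n := γ(n)/n!` (`a_n := 0` for `n < 0`). Every minor of the infinite lower-triangular Toeplitz
matrix
`(a_{i-j})_{i,j ≥ 0}` is non-negative: `(a_n)` is a Pólya frequency (totally positive) sequence.

**X (Lean, elaborated).**
`∀ (k : ℕ) (r c : Fin k → ℕ), StrictMono r → StrictMono c → 0 ≤ (Matrix.of fun i j : Fin k => if c j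
≤ r i then Literature.NumberTheory.LFunctions.xiTaylorCoeff (r i - c j) / ((r i - c j).factorial :
ℝ) else 0).det`

**Assembly (X → RH) and calibration (RH → X).** `F(w) := Σ a_n wⁿ` satisfies `F(z²) = 8 ξ(1/2 + z)`,
so `F` is entire
of order 1/2 (genus 0), `F(0) = 8ξ(1/2) > 0`, and its zeros are `w = (ρ - 1/2)²` over non-trivial
zeros `ρ`. RH ⇔ every
`ρ - 1/2` is purely imaginary ⇔ every zero of `F` is real and negative. By
Aissen–Schoenberg–Whitney–Edrei
[AissenSchoenbergWhitney1952; Edrei1952; Karlin1968 ch. 8 Thm 5.3], a real sequence with `a_0 > 0`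
is PF iff
`Σ a_n wⁿ = C e^{cw} Π(1 + α_i w)/Π(1 - β_i w)` with `c, α_i, β_i ≥ 0`, `Σ(α_i + β_i) < ∞`; for an
ENTIRE function of
order < 1 this says exactly: all zeros real ≤ 0. Hence X ⇔ RH (both directions are items; ASWE is a
cite request).

**Why this line (imports: total positivity / Laguerre–Pólya theory / combinatorics of real-rooted
polynomials).**
Pólya 1927 [Polya1927] recast RH as `Ξ ∈` Laguerre–Pólya class; GORZ [GORZ2019] proved the Jensen
polynomials
`J^{d,n}` hyperbolic for `n ≥ N(d)` (and all `n` for `d ≤ 8`), CNV [CsordasNorfolkVarga1986] the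
Turán
inequalities (= TP₂ here, up to the factor n/(n+1)), Craven–Csordas [CravenCsordas1989] the
multiplier-sequence
reading. The PF/Toeplitz-minor form is the one where (a) each instance is a certified finite
computation on the
high-precision `γ(n)` already tabulated by GORZ/Polymath15, (b) the NEGATION is Σ₁ — a single
negative minor is a
finite certificate for ¬RH — and (c) the machinery of total positivity (Karlin; Brändén–Borcea
stability preservers;
Edrei's Nevanlinna-theoretic proof) is brought to bear on ζ.
`Literature.NumberTheory.LFunctions.JensenPolyaCriterion` is the equivalent
Literature face (Pólya–Schur: `(γ(n))` is a multiplier sequence ⇔ X).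

**Ranked cruxes.**
- #2 TP₃: all 3×3 minors ≥ 0 (`k = 3` instance of X) — first order beyond the known TP₂/Turán; open
as far as I know;
  RH-implied; certifiable for bounded indices, needs the GORZ-type Hermite asymptotics for large
shifts.
- #3 (informal) asymptotic regime: for each order `k` there is `N(k)` such that all `k×k` minors
with all row indices
  `≥ N(k)` are ≥ 0 — the TP analogue of GORZ Thm 1 (their proof: `γ(n+j)/γ(n)` has a
Hermite/Gaussian profile in `j`,
  and Gaussian Toeplitz sequences are PF).
- #4 `Summit.RiemannHypothesis → X` — ASWE easy direction + Hadamard product; calibration.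
- #5 (negative side, Σ₁) `∃ k r c, StrictMono r ∧ StrictMono c ∧ det < 0` — a finite certificate for
¬RH.

**Kill criteria.** (i) #5 proved (a certified negative minor) refutes RH. (ii) #2 refuted
numerically at small indices
would ALSO refute RH — so a refutation of #2 is a kill of the problem, not the route; conversely if
#2/#3 are proved
but every proof is asymptotic-in-shift with the small-shift corner reducing to numerics of unbounded
order, close as
"GORZ corner obstruction" (the `n = 0`, `k → ∞` corner is RH itself).

**Not decomposed yet.** No Fekete-type reduction (consecutive minors suffice), no link item X ↔
JensenPolyaCriterion,
no interval-arithmetic certificate format for `γ(n)`.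

UNDER FLOOR: fewer than 2 cruxes remain after retriage (legacy route; D-0019).

Rationale: brief=widen: total positivity / Laguerre–Pólya / real-rooted combinatorics via
Aissen–Schoenberg–Whitney–Edrei; Σ1 negative side; certified-numerics friendly

Novelty: Searched 2026-08-14 (lit search --hybrid "Polya frequency sequence Taylor coefficients Riemann xi
total positivity Toeplitz minors"; lit search --source all "multiple positivity Riemann
zeta-function Katkova", "Schoenberg totally positive functions Riemann zeta"; lit galaxy search
(pdf) "multiply positive sequences Riemann zeta": 0 hits; lean search katkova_). Nearest prior art:
Katkova2006 (arXiv:math/0505174) states the thesis VERBATIM, p.4 "the Riemann Hypothesis is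
equivalent to statement that xi_1 in PF_infinity" (Thm C = AissenSchoenbergWhitney1952 + Edrei1952 +
Hadamard), and proves Thm 1 (xi_1 in PF_44: Schoenberg1955 Thm B + no zeros off the line below
height 14), Thm 2 (xi_1 in APF_m, all m), Thm 3; all now kernel-checked in-tree
(Literature.NumberTheory.LFunctions.katkova_rh_iff_pf_holds, katkova_pf44_holds, katkova_apf_holds;
PF_49, and PF_m for m+1 <= 9e12 from PlattTrudgian2021). Neighbours: Polya1927,
CsordasNorfolkVarga1986, CravenCsordas1989 (multiplier-sequence face); GORZ2019, Farmer2022 (shift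
asymptotics, critique); Chasse2013 (sector gives multiplier sequences to degree T^2); Groechenig
arXiv:2007.12889 (RH iff a Polya frequency FUNCTION condition; continuous analogue). Delta: none in
mechanism; expected grade KNOWN. Additions over Katkova: the Lean-typed minor family, the Sigma_1
negative side (TpNegativeCertificate), and TpAsymptoticRegime (entries-deep, all orders; stronger
than Thm 2 by unbounded two-way spread, but asymptotic, hence silent on PF_inf  [refs: math/0505174, 2007.12889, Katkova2006, AissenSchoenbergWhitney1952, Edrei1952, Schoenberg1955, PlattTrudgian2021, Polya1927, CsordasNorfolkVarga1986, CravenCsordas1989, GORZ2019, Farmer2022, Chasse2013]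

Barriers (technique_class: total-positivity Polya-frequency Laguerre-Polya hierarchies): technique_class: total-positivity Polya-frequency Laguerre-Polya hierarchies
* Literature.Barriers.RiemannHypothesis.JensenPolynomials (Farmer2022; `JensenPolynomials_holds`):
large-shift hyperbolicity is universal on the Kim-Farmer class, so gives nothing global. APPLIES in
TP dress, NOT evaded: the profile method behind TpAsymptoticRegime (bounded windows = Katkova's Thm
2, katkova_apf_holds, proved from the GORZ profile (15) alone) works for any Hermite-profile
sequence, zeros or not; the fixed-ORDER direction is closed by Katkova's remark (arXiv:math/0505174
p.4): PF_m for m ~ pi x (verified RH height) follows from Schoenberg's Thm B "but it is impossible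
to prove the Riemann hypothesis with the help of this method". The route's kill criterion (ii) is
this barrier, and it is met.
* Literature.Barriers.RiemannHypothesis.NewmanConjecture (RodgersTaoFMP2020): neutral for the exact
equivalence X <-> RH (katkova_rh_iff_pf_holds) but forbids proving PF_k with a k-uniform margin. Not
evaded: no k-uniform mechanism is named.
* Literature.Barriers.RiemannHypothesis.DeBrangesPositivity (ConreyLi2000): de Branges-form
positivity, not Toeplitz minors; does not apply.
* Literature.Barriers.RiemannHypothesis.FeketePolyaPositivity (chi_-163): same SHAPE elsewhere
(positivity hierarchy failing at every finite order, target true); here all finite orders HOLD and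
the content sits at k = infinity; analogy only.
Summary: no evasion; KNOWN RH-equivalent, finite approximants uninformative.

History (route lifecycle, newest last):
- 2026-08-15T12:54:28Z · CLOSED superseded — superseded:route-RiemannHypothesis-AngularHeatFlow (planner-RiemannHypothesis-route-RiemannHypothesis-TotalPosit)

sub-problem: RiemannHypothesis · status: closed(superseded) · opened planner-RiemannHypothesis-Survey-0 2026-08-13T06:09:54Z · rev 1 · ledger route-RiemannHypothesis-TotalPositivity
GENERATED by the gate from the ledger (D-0016/17). Provers cite these decls: `theorem foo : Summit.RiemannHypothesis.RiemannHypothesis.Theses.TotalPositivity.<Decl> := …` in Summits/RiemannHypothesis/RiemannHypothesis/Theorems/<Name>.lean.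
-/

namespace Summit.RiemannHypothesis.RiemannHypothesis.Theses.TotalPositivity

open scoped BigOperators Topology Manifold Classical MeasureTheory ProbabilityTheory Matrix InnerProductSpace ComplexConjugate ContinuousMap
open Filter Set Function TopologicalSpace MeasureTheory

attribute [summit_statement] _root_.Summit.RiemannHypothesis

open Summit

/-- item stmt-RiemannHypothesis-0301 · target · rank 0 · closed · moot by None · by planner
why it might fail: X IS RH: RH <-> X is proved in-tree (Literature.NumberTheory.LFunctions.katkova_rh_iff_pf_holds; Katkova2006 Thm C). Every fixed order k is a theorem (PF_49 in-tree; PF_m, m+1 <= 9e12, from PlattTrudgian2021 via Schoenberg's sector Thm B); Katkova p.4: the sector method cannot reach PF_infinity. No 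
sources: Katkova2006 = arXiv:math/0505174, §1 Thm C, Thm 1 and the remark after it (p.4), Literature.NumberTheory.LFunctions.katkova_rh_iff_pf_holds (Literature/NumberTheory/LFunctions/XiMultiplePositivityProofs.lean), Literature.NumberTheory.LFunctions.isMultiplyPositiveSeq_xi_fortyNine, Literature.NumberTheory.LFunctions.isMultiplyPositiveSeq_xi_of_plattTrudgian (KatkovaPF44Proofs.lean); PlattTrudgian2021 Thm 1, Literature.Barriers.RiemannHypothesis.JensenPolynomials (Farmer2022 §§2,4)
Thesis X of route TotalPositivity: with a_n = xiTaylorCoeff n / n! (a_n = 0 for n < 0), every k×k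
minor of the lower-triangular Toeplitz matrix (a_{i−j}) — rows r, columns c strictly increasing — is
≥ 0. Equivalent to RH by Aissen–Schoenberg–Whitney–Edrei [AissenSchoenbergWhitney1952; Edrei1952;
Karlin1968 ch. 8] applied to F(w) = Σ a_n wⁿ, F(z²) = 8ξ(1/2+z), entire of order 1/2 with zeros
(ρ−1/2)². Pólya's Laguerre–Pólya programme [Polya1927; CsordasNorfolkVarga1986; CravenCsordas1989;
GORZ2019] in totally-positive form. -/
@[route_item "route-RiemannHypothesis-TotalPositivity", crux]
def TpThesis : Prop :=
  ∀ (k : ℕ) (r c : Fin k → ℕ), StrictMono r → StrictMono c → 0 ≤ (Matrix.of fun i j : Fin k => if c j ≤ r i then Literature.NumberTheory.LFunctions.xiTaylorCoeff (r i - c j) / ((r i - c j).factorial : ℝ) else 0).det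

/-- item stmt-RiemannHypothesis-0303 · support · rank 2 · closed · moot by None · by planner
sources: Katkova2006 Thm 1 (xi_1 in PF_44), arXiv:math/0505174 p.4, Literature.NumberTheory.LFunctions.katkova_pf44_holds + Literature.NumberTheory.LFunctions.katkova_pf44.order_three (KatkovaPF44Proofs.lean / XiMultiplePositivity.lean)
Order-3 instance of X. Order 2 (log-concavity of γ(n)/n!) follows from the Turán inequalities γ(n)²
≥ γ(n−1)γ(n+1) [CsordasNorfolkVarga1986] and positivity (xiTaylorCoeff_pos); order 3 is NOT the
Dimitrov–Lucas/GORZ degree-3 Jensen hyperbolicity and appears open. RH-implied. Attack: (a) large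
shifts via the Hermite/Gaussian profile of γ(n+j)/γ(n) [GORZ2019 Thm 3-type asymptotics] since
Gaussian Toeplitz sequences are strictly TP; (b) bounded indices by certified interval arithmetic on
tabulated γ(n). -/
@[route_item "route-RiemannHypothesis-TotalPositivity"]
def TpOrderThree : Prop :=
  ∀ (r c : Fin 3 → ℕ), StrictMono r → StrictMono c → 0 ≤ (Matrix.of fun i j : Fin 3 => if c j ≤ r i then Literature.NumberTheory.LFunctions.xiTaylorCoeff (r i - c j) / ((r i - c j).factorial : ℝ) else 0).det

/-- item stmt-RiemannHypothesis-0304 · support · rank 3 · closed · moot by None · by planner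
why it might fail: Residual open case = order k > 9e12, unbounded two-way spread: window asymptotics (GORZ (15), Katkova Prop 1) + Fekete need a fixed column window; spread-uniform positivity sees the global zero set, so a proof may need shrinking zero-free sectors (quasi-RH) - or, if universal, says nothing on X.
sources: Katkova2006 Def 3 / Thm 2 / Prop 1 (arXiv:math/0505174 pp.4-5); Literature.NumberTheory.LFunctions.katkova_apf_holds, Literature.Analysis.TotalPositivity.ToeplitzAsymp.det_toeplitz_eventually_pos, GORZ2019 Thms 1, 3 (arXiv:1902.07321 p.3), Literature.Barriers.RiemannHypothesis.JensenPolynomials (Farmer2022 §§2,4: large-shift statements are universal)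
For every k there is N(k) such that every k×k minor of (a_{i−j}), a_n = xiTaylorCoeff n / n!, with
all row indices r i ≥ N(k) is ≥ 0 (indeed > 0). TP analogue of Griffin–Ono–Rolen–Zagier Thm 1
[GORZ2019]: their proof shows the renormalised shifts of γ have Hermite (Gaussian) limits with
effective error, and Toeplitz matrices of Gaussian sequences e^{−αn²−βn} are strictly totally
positive [Karlin1968 ch. 3]. Lean signature deferred: quantifier shape '∃ N, ∀ r c, (∀ i, N ≤ r i) →
…' over Fin k is typable now (no new definition needed) — grounder may promote to: ∀ k : ℕ, ∃ N : ℕ,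
∀ (r c : Fin k → ℕ), StrictMono r → StrictMono c → (∀ i, N ≤ r i) → 0 ≤ det(…). Filed informal
pending refuter check that the column-index freedom does not make it false trivially (columns c j >
r i give zero rows: harmless, det = 0). -/
@[route_item "route-RiemannHypothesis-TotalPositivity"]
def TpAsymptoticRegime : Prop :=
  ∀ k : ℕ, ∃ N : ℕ, ∀ (r c : Fin k → ℕ), StrictMono r → StrictMono c → (∀ i j, c j ≤ r i → N ≤ r i - c j) → 0 ≤ (Matrix.of fun i j : Fin k => if c j ≤ r i then Literature.NumberTheory.LFunctions.xiTaylorCoeff (r i - c j) / ((r i - c j).factorial : ℝ) else 0).det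

/-- item stmt-RiemannHypothesis-0305 · support · rank 4 · closed · moot by None · by planner
sources: Katkova2006 §1 Thm C (arXiv:math/0505174 p.4), Literature.NumberTheory.LFunctions.katkova_rh_iff_pf_holds (.mp)
Under RH the zeros w_k = (ρ_k − 1/2)² of F(w) = Σ (xiTaylorCoeff n / n!) wⁿ are real negative, F has
order 1/2 and F(0) = xiTaylorCoeff 0 > 0, so F(w) = F(0) Π (1 + w/|w_k|) (Hadamard, genus 0); each
factor 1 + αw (α ≥ 0) has PF coefficient sequence, PF sequences are closed under convolution
(Cauchy–Binet) and coefficientwise limits, so (a_n) is PF [AissenSchoenbergWhitney1952 §1;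
Karlin1968 ch. 8]. Shows X is exactly RH-strength. -/
@[route_item "route-RiemannHypothesis-TotalPositivity"]
def TpConverse : Prop :=
  Summit.RiemannHypothesis → ∀ (k : ℕ) (r c : Fin k → ℕ), StrictMono r → StrictMono c → 0 ≤ (Matrix.of fun i j : Fin k => if c j ≤ r i then Literature.NumberTheory.LFunctions.xiTaylorCoeff (r i - c j) / ((r i - c j).factorial : ℝ) else 0).det

/-- item stmt-RiemannHypothesis-0306 · support · rank 5 · closed · moot by None · by planner
why it might fail: Believed FALSE (not X <-> not RH by katkova_rh_iff_pf_holds). Any witness needs order k >= 50 unconditionally (PF_49 in-tree) and k > 9e12 given PlattTrudgian2021 (isMultiplyPositiveSeq_xi_of_plattTrudgian): no feasible certified search.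
sources: Literature.NumberTheory.LFunctions.isMultiplyPositiveSeq_xi_fortyNine, Literature.NumberTheory.LFunctions.isMultiplyPositiveSeq_xi_of_plattTrudgian (KatkovaPF44Proofs.lean), Katkova2006 Thm 1 + remark p.4 (arXiv:math/0505174)
Negation of X: a single k×k minor with det < 0. By #4 this refutes RH; it is a finite statement
about finitely many Taylor coefficients γ(n) of Ξ, each a computable real (certified enclosures
exist to thousands of digits for n ≤ 10^3 and beyond [GORZ2019 §4; Polymath2019]), so it is
decidable-in-principle by interval arithmetic (Literature/Analysis/ValidatedNumerics). Filed so
refuters can run a certified search over small (k, r, c). -/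
@[route_item "route-RiemannHypothesis-TotalPositivity"]
def TpNegativeCertificate : Prop :=
  ∃ (k : ℕ) (r c : Fin k → ℕ), StrictMono r ∧ StrictMono c ∧ (Matrix.of fun i j : Fin k => if c j ≤ r i then Literature.NumberTheory.LFunctions.xiTaylorCoeff (r i - c j) / ((r i - c j).factorial : ℝ) else 0).det < 0

/-- item stmt-RiemannHypothesis-0302 · assembly · rank 1 · closed · moot by None · by planner
If (a_n) is PF then by ASWE–Edrei F(w) = Σ a_n wⁿ = C e^{cw} Π(1+α_i w)/Π(1−β_i w) with c, α_i, β_i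
≥ 0; F is entire (F(z²) = 8ξ(1/2+z), from riemannXi and xiTaylorCoeff) so no β_i, hence every zero
of F is real negative; zeros of F are (ρ − 1/2)² over non-trivial zeros ρ (riemannXi_eq_zero_iff,
fact), so ρ − 1/2 is purely imaginary: RH. Expected hypotheses: named fact aswe_edrei (cite filed),
Literature.NumberTheory.LFunctions.riemannXi_eq_zero_iff, the Taylor expansion fact defining
xiTaylorCoeff,
Literature.NumberTheory.LFunctions.riemannHypothesis_iff_im_eq_zero_of_riemannXiUpper_eq_zero. -/
@[route_item "route-RiemannHypothesis-TotalPositivity"]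
def Assembly : Prop :=
  (∀ (k : ℕ) (r c : Fin k → ℕ), StrictMono r → StrictMono c → 0 ≤ (Matrix.of fun i j : Fin k => if c j ≤ r i then Literature.NumberTheory.LFunctions.xiTaylorCoeff (r i - c j) / ((r i - c j).factorial : ℝ) else 0).det) → Summit.RiemannHypothesis

end Summit.RiemannHypothesis.RiemannHypothesis.Theses.TotalPositivity
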